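import Summits.BirchSwinnertonDyer.BirchSwinnertonDyer.Theorems.ClassRecordThreeCornerAtThreeKolyImageIndexFormGenericEnd
import Summits.BirchSwinnertonDyer.BirchSwinnertonDyer.Theorems.ClassRecordThreeShimuraKolyvaginImageInputs
import Summits.BirchSwinnertonDyer.BirchSwinnertonDyer.Theorems.ClassRecordThreeShimuraKolyvaginImageDisjoint
import Summits.BirchSwinnertonDyer.BirchSwinnertonDyer.Theorems.ErratumRoadFiveNonSurjCornerImageFull
import Summits.BirchSwinnertonDyer.BirchSwinnertonDyer.Theorems.ErratumRoadFiveNonSurjCornerMinusOneAtFive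
import Summits.BirchSwinnertonDyer.BirchSwinnertonDyer.Theorems.ErratumRoadFiveShimuraKolyvaginOrderBoundInertLocalSplit
import Summits.BirchSwinnertonDyer.Rank1Residual.X11b.RingClassFieldNoTorsionOfIrreducible
import Summits.BirchSwinnertonDyer.Rank1Residual.X11b.Three.GaloisImageNegOne
import Literature.NumberTheory.EllipticCurves.HeegnerPointsKolyvaginProp81FrobeniusProofs
import Literature.NumberTheory.EllipticCurves.BSDSelmerCMPConverseHeegnerFieldProofs
import Literature.NumberTheory.EllipticCurves.WeilPairingProofs
import HarnessLib

/-!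
# Route `ErratumRoadFive` (rung K2), crux `NonSurjCorner` (item stmt-BirchSwinnertonDyer-19065; child 19947 `NonSurjCornerKolyJ`):
# THE IMAGE INPUTS OF THE INERT SHIMURA–KOLYVAGIN ORDER MACHINE ON THE p ≥ 5 CORNER, and Kolyvagin's UNSHARP ORDER bound
# `#Ш(E/K)[p^∞] ≤ p^(2·ord_p[E(K):ℤy])` on INERT Shimura frames (`p ∈ S`) for EVERY multiplicative `p ≥ 5` with `E[p]` irreducible
# — surjective OR NOT — modulo {Poitou–Tate, `casselsTate_levelInputs`, the labelled CM family}
# (cell `bsd-stepL`, seat `bsd-stepL-corner-p1` g12; `--supports stmt-BirchSwinnertonDyer-19065 --as helper`)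

WHY THIS FILE. Lane A's X₀(N) road for the (T4′) corner (crux child 19947, line `Cruxes/NonSurjCornerKolyJ/Lines/birth.lean`) stands,
after g11 ∕ p573171, as: `stub_kolyJ_max` ⟸ {Gross 3.7 (2), Poitou–Tate, GZ III (3.1)} and `stub_kolyJ_multi` = the SUM form over
carriers — beyond every Kolyvagin-system argument (Jetchev's walk is memoryless across carriers: at every minimal core vertex the
empty-sign dual stringent Selmer module is `⊕_i ℤ/p^{t_i}`, and one Kolyvagin prime absorbs a cyclic piece; BCGS Thm. 2 gets the sum
from the anticyclotomic IMC). The census (CORNER-G7 §1; g3 `corner57.tsv`) shows WHERE the sum form bites at `p = 5`: 3 pairs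
(84960d1, 296240ce1, 304560by1), each with TWO split multiplicative carriers {`5` itself (`c₅ = 5`), `q ∈ {59, 7, 47}` (`c_q = 5`)}.
On a Shimura curve `X_{N⁺,N⁻}` with BOTH carriers INERT in `K` (`N⁻ = 5·q`, two primes: the indefinite case) the carrier places are
principal (`v = ℓ𝓞_K` splits completely in every `K[n]`), Kolyvagin's classes are Selmer there for free (reading (R1) of item 19718,
`ErratumRoadFiveShimuraKolyvaginOrderBoundInertLocalSplit`), and no Tamagawa sharpening is needed on the X₀(N) side — the CARRIER-INERT
road that is the line of record of the @3 corner (19111 `Lines/inert.lean`, lane B corner3-p2). Lane B g5 made the Kolyvagin ORDER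
machine `p`-GENERIC and IMAGE-KEYED (`ShimuraKolyvaginOfImage.natCard_sha_primary_le_of_shimuraLabels_of_imageInputs_of_casselsTate_of_poitouTate`,
p-generic END, «by-product for crux 19065 at p ∈ {5,7}»): it reads the image of `ρ̄_{E,p}` only through four inputs over `K` —
(hIz) some `z ∈ Γ_K` acts as `−1` on `E(K̄)[p]`, (hIs) `E(K̄)[p]` simple, (hIc) scalar commutant, (hIt) `E(K)[p] = 0` — plus ring-class
no-torsion. THIS FILE supplies those inputs at every multiplicative `p ≥ 5` with `E[p]` irreducible (so on the whole (T4′) corner):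

* §1 `kolyvaginImageInputs_of_exists_smul_eq_neg` (ANY odd `p`): the four inputs over `K` from `Irr W p`, an inert∕split frame with
  `p ∤ d_K`, and ONE element of `Γ_ℚ` acting as `−1` on `E[p]` — the frame has a prime `q ∣ d_K`, `q ∤ Np`, so `K ⊄ ℚ(E[p])` and every
  `γ ∈ Γ_ℚ` is matched on `E[p]` by some `g ∈ Γ_K` (lane B's `exists_smul_torsionEquiv_eq`); irreducibility ∕ commutant by lane B's
  `p`-generic `hasIrreducibleModPGaloisRep_baseChange` ∕ `exists_eq_zsmul_baseChange_of_irr`; `E(K)[p] = 0` by BCGS (tor)⟸(irr).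
* §2 `exists_smul_eq_neg_of_mult_of_irr_of_five_le`: `−1 ∈ ρ̄_{E,p}(Γ_ℚ)` for EVERY multiplicative `p ≥ 5` with `E[p]` irreducible —
  onto: trivial; not onto: `p = 5` x11c ∕ this seat g8 (`GaloisImage.exists_smul_eq_neg_five_of_irr`), `p ≥ 7` lane B corner5-p2
  (`CornerShape.exists_smul_eq_neg_of_mult_of_irr_of_not_surj`: the image is the full normaliser of a split Cartan). Hence
  `kolyvaginImageInputs_of_mult_of_irr_of_five_le` and the corner packaging `NonSurjCorner.kolyvaginImageInputs`.
* §3 `isPrime_span_natCast_of_inertClause`, `ringClass_noTorsion_of_irr_of_inert`: the inert clause of item 19718 at `p ∈ S` makes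
  `p𝓞_K` prime, hence `p` unramified in `K`, hence x11b3's `NoTorsionIrr` gives `E(K[k'])[p^∞] = 0` for `p ∤ k'`.
* §4 END `natCard_sha_primary_le_of_shimuraLabels_of_mult_of_irr_of_casselsTate_of_poitouTate`: Kolyvagin's UNSHARP ORDER bound on
  the inert Shimura locus for EVERY multiplicative `p ≥ 5` with `E[p]` irreducible (image onto OR NOT), modulo {`hPT`, `hCT`, the
  labelled CM family (B2)–(B5)} — the statement of item 19718 `ShimuraKolyvaginOrderBoundInertFromFive` in LABEL currency with its
  binder `W.HasSurjectiveModNGaloisRep p` REPLACED by `Irr W p ∧ Mult W p`; and `NonSurjCorner.natCard_sha_primary_le_of_shimuraLabels`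
  on the (T4′) corner binders.

WHAT THIS OFFERS THE PLANNER (no line is opened here): an INERT line for 19065 — for a corner pair `(E, p)` and an admissible
`N⁻ ∋ p` (even number of primes of `N` exactly dividing it, e.g. `N⁻ = p·q` at the three multi-carrier pairs), the Euler-system half
needs NO Tamagawa sum and NO surjectivity; its named inputs are those of 19111's `stub_upper3_inertDisplay` road (Poitou–Tate, the
Cassels–Tate level inputs, CM-point primitives on `X_{N⁺,N⁻}` at `p ∈ S` for irreducible `E[p]`, the degree link ∕ CST display).

HONEST FRAMING: THEOREMS ONLY (no definition, no named fact, no `sorry`); every END is CONDITIONAL on the displayed binders (Poitou–Tate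
sum formula, `casselsTate_levelInputs`, the labelled family); no stub of 19947 is discharged, items 19065 ∕ 19947 ∕ 19718 stay OPEN;
nothing about any curve's BSD; BSD is not advanced; T7. Credit: lane B corner3-p2 g5 (the image-keyed `p`-generic machine and its END),
shim3b (image leaves), shim-p1 (the inert chain, (R1)), corner5-p2 g2 (`−1` at `p ≥ 7`), x11c ∕ g8 (`−1` at 5), x11b3 (`NoTorsionIrr`).
References (locators only): [cite: Kim2024, Thm. 4.3 (printed twin, ρ̄ onto)] [cite: Nekovar2007, §§2–4] [cite: GrossLMS1991, §9, Prop. 9.3]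
[cite: McCallumLMS1991, §1 Theorem, §3 Cor. 3.2, §5] [cite: Serre1972, §2.2, §2.7 Prop. 17] [cite: BurungaleEtAl2026, Thm. 1 (tor)⟸(irr)]
[cite: Jetchev2008, §6 Thm. 6.3 (the max-form mechanism)] [cite: MilneADT2006, Ch. I Thm. 4.10(b), Thm. 6.13(a)].
-/

set_option autoImplicit false
set_option linter.dupNamespace false -- `Summit.BirchSwinnertonDyer.BirchSwinnertonDyer` (summit = problem), tree-wide

noncomputable section

open scoped Classical NumberField

open Field WeierstrassCurve NumberField IsDedekindDomain
  Literature.NumberTheory.EllipticCurves Literature.NumberTheory.GaloisRepresentations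
  Literature.NumberTheory.EllipticCurves.Rank1Residual
  Summit.BirchSwinnertonDyer.Rank1Residual Summit.BirchSwinnertonDyer.Rank1Residual.X11b

namespace Summit.BirchSwinnertonDyer.BirchSwinnertonDyer.Theorems.ShimuraKolyvaginOfImage

open Summit.BirchSwinnertonDyer.BirchSwinnertonDyer.Theorems.ShimuraKolyvaginImageDisjoint
  Summit.BirchSwinnertonDyer.BirchSwinnertonDyer.Theorems.ShimuraKolyvaginImageInputs

/-! ### §1 The four image inputs over `K` from one element of `Γ_ℚ` acting as `−1` (any odd `p`) -/

/-- **The four image inputs of the Kolyvagin ORDER machine over `K`, for ANY odd `p`, from `Irr W p` and `−1 ∈ ρ̄_{E,p}(Γ_ℚ)`.**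
For `E = W/ℚ` of conductor `N` with `E[p]` irreducible, `K` imaginary quadratic, an inert set `S` of primes of `N` none dividing
`d_K`, every other prime of `N` split in `K`, `p ∤ d_K`, and some `γ ∈ Γ_ℚ` acting as `−1` on `E[p]`: (hIz) some `z ∈ Γ_K` acts as
`−1` on `E(K̄)[p]`; (hIs) `E(K̄)[p]` is a simple `Γ_K`-module; (hIc) its `Γ_K`-commutant is scalar; (hIt) `E(K)[p] = 0`. KEY: `d_K`
has a prime factor `q`, and `q ∤ Np` (the primes of `N` are split or inert-unramified, `p ∤ d_K`), so `K ⊄ ℚ(E[p])` and every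
`γ ∈ Γ_ℚ` is matched on `E[p]` by some `g ∈ Γ_K` (lane B `exists_smul_torsionEquiv_eq`). Lane B's `kolyvaginImageInputs_three_of_not_dvd_discr`
made `p`-generic, with the `−1` supplied as a hypothesis. [cite: GrossLMS1991, §9 (PDF p. 227) and Prop. 9.3] [cite: BurungaleEtAl2026, Thm. 1 (tor)] -/
theorem kolyvaginImageInputs_of_exists_smul_eq_neg (K : Type) [Field K] [NumberField K] (W : WeierstrassCurve ℚ)
    [W.IsElliptic] {p : ℕ} [Fact p.Prime] (hp2 : p ≠ 2) {N : ℕ} (S : Finset ℕ)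
    (hN : W.conductorNorm ℤ = N) (hirr : W.HasIrreducibleModPGaloisRep p)
    (hK : IsImaginaryQuadratic K)
    (hS : ∀ ℓ ∈ S, ℓ.Prime ∧ ℓ ∣ N ∧ ¬ ℓ ^ 2 ∣ N ∧
      ((Ideal.span {(ℓ : ℤ)}).primesOver (𝓞 K)).ncard = 1 ∧ ¬ (ℓ : ℤ) ∣ NumberField.discr K)
    (hsplit : ∀ ℓ : ℕ, ℓ.Prime → ℓ ∣ N → ℓ ∉ S →
      ((Ideal.span {(ℓ : ℤ)}).primesOver (𝓞 K)).ncard = 2)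
    (hpd : ¬ (p : ℤ) ∣ NumberField.discr K)
    (hneg : ∃ γ : absoluteGaloisGroup ℚ, ∀ P : geomTorsion W p, γ • P = -P) :
    (∃ z : absoluteGaloisGroup K, ∀ Q : geomTorsion (W.baseChange K) p, z • Q = -Q) ∧
      (W.baseChange K).HasIrreducibleModPGaloisRep p ∧
      (∀ f : geomTorsion (W.baseChange K) p →+ geomTorsion (W.baseChange K) p,
        (∀ (g : absoluteGaloisGroup K) (t : geomTorsion (W.baseChange K) p),
          f (g • t) = g • f t) → ∃ k : ℤ, ∀ t, f t = k • t) ∧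
      AddSubgroup.torsionBy (W.baseChange K).toAffine.Point (p : ℤ) = ⊥ := by
  have hp : p.Prime := Fact.out
  -- a prime `q ∣ d_K` with `q ∤ N`, `q ≠ p`
  obtain ⟨q, hq, hqd, hqN⟩ :=
    exists_prime_dvd_discr_not_dvd K hK.1 S (fun ℓ hℓ ↦ (hS ℓ hℓ).2.2.2.2) hsplit
  have hqN' : ¬ q ∣ W.conductorNorm ℤ := by rwa [hN]
  have hqp : ¬ (q : ℤ) ∣ (p : ℤ) := fun h ↦ by
    have h' : q ∣ p := by exact_mod_cast h
    have hqp' : q = p := (Nat.prime_dvd_prime_iff_eq hq hp).mp h'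
    subst hqp'
    exact hpd hqd
  refine ⟨?_, ?_, ?_, ?_⟩
  · obtain ⟨γ, hγ⟩ := hneg
    obtain ⟨g, hg⟩ := exists_smul_torsionEquiv_eq W K hK.1 hq hqd hqN' hqp γ
    refine ⟨g, fun Q ↦ ?_⟩
    obtain ⟨P, rfl⟩ := (RatClosure.torsionEquiv (K := K) W (p : ℤ)).surjective Q
    rw [hg, hγ, map_neg]
  · exact hasIrreducibleModPGaloisRep_baseChange W K hK.1 hq hqd hqN' hqp hirr
  · exact fun f hf ↦ exists_eq_zsmul_baseChange_of_irr W K hK.1 hq hqd hqN' hp2 hqp hirr f hf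
  · exact torsionBy_eq_bot_of_isImaginaryQuadratic_of_hasIrreducibleModPGaloisRep W K hK hp hirr

/-! ### §2 `−1 ∈ ρ̄_{E,p}(Γ_ℚ)` at every multiplicative `p ≥ 5` with `E[p]` irreducible; the inputs there and on the corner -/

/-- **`−1 ∈ ρ̄_{E,p}(Γ_ℚ)` for EVERY `p ≥ 5` of multiplicative reduction with `E[p]` irreducible** — image onto: negation is in
`GL₂(𝔽_p)` (`exists_smul_eq_neg_of_surj`); not onto, `p = 5`: x11c ∕ this seat g8 `GaloisImage.exists_smul_eq_neg_five_of_irr` (every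
irreducible mod-5 image contains `−1`); not onto, `p ≥ 7`: lane B corner5-p2 `CornerShape.exists_smul_eq_neg_of_mult_of_irr_of_not_surj`
(the image is the FULL normaliser of a split Cartan subgroup — the inertia half-Cartan at the multiplicative `p` and one element of
`N ∖ C` generate `N(C) ∋ −I`). [cite: Serre1972, §2.2, §2.7 Prop. 17] [cite: SilvermanAEC2009, App. C §14 (Tate curve)] -/
theorem exists_smul_eq_neg_of_mult_of_irr_of_five_le (W : WeierstrassCurve ℚ) [W.IsElliptic] [W.IsGloballyMinimal]
    (p : ℕ) [Fact p.Prime] (h5 : 5 ≤ p) (hmult : Mult W p) (hirr : Irr W p) :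
    ∃ γ : absoluteGaloisGroup ℚ, ∀ P : geomTorsion W p, γ • P = -P := by
  have hp : p.Prime := Fact.out
  by_cases hs : Surj W p
  · exact W.exists_smul_eq_neg_of_surj hs
  · rcases Nat.lt_or_ge p 7 with hlt | h7
    · -- `5 ≤ p < 7`, `p` prime ⟹ `p = 5`
      have hp5 : p = 5 := by
        interval_cases p
        · rfl
        · exact absurd hp (by norm_num)
      subst hp5
      exact GaloisImage.exists_smul_eq_neg_five_of_irr W hirr
    · exact CornerShape.exists_smul_eq_neg_of_mult_of_irr_of_not_surj W p h7 hmult hirr hs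

/-- **The four image inputs over `K` at EVERY multiplicative `p ≥ 5` with `E[p]` irreducible, on an inert∕split frame with
`p ∤ d_K`** — §1 with the `−1` of `exists_smul_eq_neg_of_mult_of_irr_of_five_le`. NO surjectivity. [cite: GrossLMS1991, §9, Prop. 9.3] -/
theorem kolyvaginImageInputs_of_mult_of_irr_of_five_le (K : Type) [Field K] [NumberField K] (W : WeierstrassCurve ℚ)
    [W.IsElliptic] [W.IsGloballyMinimal] {p : ℕ} [Fact p.Prime] (h5 : 5 ≤ p) (hmult : Mult W p) (hirr : Irr W p)
    {N : ℕ} (S : Finset ℕ) (hN : W.conductorNorm ℤ = N) (hK : IsImaginaryQuadratic K)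
    (hS : ∀ ℓ ∈ S, ℓ.Prime ∧ ℓ ∣ N ∧ ¬ ℓ ^ 2 ∣ N ∧
      ((Ideal.span {(ℓ : ℤ)}).primesOver (𝓞 K)).ncard = 1 ∧ ¬ (ℓ : ℤ) ∣ NumberField.discr K)
    (hsplit : ∀ ℓ : ℕ, ℓ.Prime → ℓ ∣ N → ℓ ∉ S →
      ((Ideal.span {(ℓ : ℤ)}).primesOver (𝓞 K)).ncard = 2)
    (hpd : ¬ (p : ℤ) ∣ NumberField.discr K) :
    (∃ z : absoluteGaloisGroup K, ∀ Q : geomTorsion (W.baseChange K) p, z • Q = -Q) ∧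
      (W.baseChange K).HasIrreducibleModPGaloisRep p ∧
      (∀ f : geomTorsion (W.baseChange K) p →+ geomTorsion (W.baseChange K) p,
        (∀ (g : absoluteGaloisGroup K) (t : geomTorsion (W.baseChange K) p),
          f (g • t) = g • f t) → ∃ k : ℤ, ∀ t, f t = k • t) ∧
      AddSubgroup.torsionBy (W.baseChange K).toAffine.Point (p : ℤ) = ⊥ :=
  have hp2 : p ≠ 2 := by omega
  kolyvaginImageInputs_of_exists_smul_eq_neg K W hp2 S hN hirr hK hS hsplit hpd
    (exists_smul_eq_neg_of_mult_of_irr_of_five_le W p h5 hmult hirr)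

/-- **The four image inputs on the (T4′) corner** (`ClassX11b W p`, `¬ Surj W p`, `p ∈ {5, 7}`; item 19065) on an INERT Shimura frame
with `p ∈ S` (so `p ∤ d_K` is the last conjunct of the inert clause at `p`). [cite: GrossLMS1991, §9, Prop. 9.3] -/
theorem NonSurjCorner.kolyvaginImageInputs (K : Type) [Field K] [NumberField K] (W : WeierstrassCurve ℚ)
    [W.IsElliptic] [W.IsGloballyMinimal] {p : ℕ} [Fact p.Prime] (hX : ClassX11b W p) (_hns : ¬ Surj W p)
    (h57 : p = 5 ∨ p = 7) {N : ℕ} (S : Finset ℕ) (hN : W.conductorNorm ℤ = N) (hK : IsImaginaryQuadratic K)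
    (hS : ∀ ℓ ∈ S, ℓ.Prime ∧ ℓ ∣ N ∧ ¬ ℓ ^ 2 ∣ N ∧
      ((Ideal.span {(ℓ : ℤ)}).primesOver (𝓞 K)).ncard = 1 ∧ ¬ (ℓ : ℤ) ∣ NumberField.discr K)
    (hsplit : ∀ ℓ : ℕ, ℓ.Prime → ℓ ∣ N → ℓ ∉ S →
      ((Ideal.span {(ℓ : ℤ)}).primesOver (𝓞 K)).ncard = 2)
    (hpS : p ∈ S) :
    (∃ z : absoluteGaloisGroup K, ∀ Q : geomTorsion (W.baseChange K) p, z • Q = -Q) ∧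
      (W.baseChange K).HasIrreducibleModPGaloisRep p ∧
      (∀ f : geomTorsion (W.baseChange K) p →+ geomTorsion (W.baseChange K) p,
        (∀ (g : absoluteGaloisGroup K) (t : geomTorsion (W.baseChange K) p),
          f (g • t) = g • f t) → ∃ k : ℤ, ∀ t, f t = k • t) ∧
      AddSubgroup.torsionBy (W.baseChange K).toAffine.Point (p : ℤ) = ⊥ :=
  have h5 : 5 ≤ p := by rcases h57 with rfl | rfl <;> norm_num
  kolyvaginImageInputs_of_mult_of_irr_of_five_le K W h5 hX.2.2.1 hX.2.2.2 S hN hK hS hsplit (hS p hpS).2.2.2.2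

/-! ### §3 Ring-class no-torsion at an inert `p` -/

/-- **The inert clause of item 19718 makes `p𝓞_K` a prime ideal**: for `K` imaginary quadratic, `ℓ` prime with exactly one prime of
`𝓞 K` above it and `ℓ ∤ d_K`, `(ℓ) ⊂ 𝓞_K` is prime (the one prime above `ℓ` IS `ℓ𝓞_K`, shim-p1's
`asIdeal_eq_span_natCast_of_ncard_primesOver_eq_one`). [cite: NeukirchANT1999, Ch. I (8.3), Ch. III Cor. (2.12)] -/
theorem isPrime_span_natCast_of_inertClause {K : Type} [Field K] [NumberField K] (hK : IsImaginaryQuadratic K)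
    {ℓ : ℕ} (hℓ : ℓ.Prime) (hg : ((Ideal.span {(ℓ : ℤ)}).primesOver (𝓞 K)).ncard = 1)
    (hd : ¬ (ℓ : ℤ) ∣ NumberField.discr K) : (Ideal.span {(ℓ : 𝓞 K)}).IsPrime := by
  obtain ⟨P, hP⟩ := Set.ncard_eq_one.mp hg
  have hPmem : P ∈ (Ideal.span {(ℓ : ℤ)}).primesOver (𝓞 K) := by rw [hP]; exact Set.mem_singleton P
  obtain ⟨hPprime, hPover⟩ := hPmem
  have hne : Ideal.span {(ℓ : ℤ)} ≠ ⊥ := by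
    rw [Ne, Ideal.span_singleton_eq_bot]
    exact_mod_cast hℓ.ne_zero
  have hPne : P ≠ ⊥ := Ideal.ne_bot_of_liesOver_of_ne_bot hne P
  let v : HeightOneSpectrum (𝓞 K) := ⟨P, hPprime, hPne⟩
  have hmemP : ((ℓ : ℕ) : 𝓞 K) ∈ v.asIdeal := by
    have h1 : (ℓ : ℤ) ∈ P.under ℤ := by
      rw [← hPover.over]; exact Ideal.mem_span_singleton_self _
    rw [Ideal.under_def, Ideal.mem_comap] at h1
    simpa using h1
  have hv : v.asIdeal = Ideal.span {((ℓ : ℕ) : 𝓞 K)} :=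
    asIdeal_eq_span_natCast_of_ncard_primesOver_eq_one hK hℓ hg hd hmemP
  rw [← hv]
  exact hPprime

/-- **Ring-class no-torsion at an INERT `p` for irreducible `E[p]`** (`p` odd): `E(K[k'])` has no `p`-power torsion for every
conductor `k' ≥ 1` prime to `p` — x11b3's `NoTorsionIrr.torsionBy_pow_ringClassField_eq_bot_of_hasIrreducibleModPGaloisRep` (Irr,
the PROVED Weil pairing, `p` unramified in `K`, `p ∤ k'`), the unramifiedness from `(p) ⊂ 𝓞_K` prime
(`isUnramifiedIn_of_span_natCast_isPrime`). The binder `htor` of lane B's `p`-generic END, in its exact shape.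
[cite: GrossLMS1991, Lemma 4.3 (the no-torsion it replaces)] [cite: NeukirchANT1999, Ch. I (8.3)] -/
theorem ringClass_noTorsion_of_irr_of_inert {K : Type} [Field K] [NumberField K] (hK : IsImaginaryQuadratic K)
    (ι : K →+* ℂ) (W : WeierstrassCurve ℚ) [W.IsElliptic] {p : ℕ} (hp : p.Prime) (hp2 : p ≠ 2)
    (hirr : W.HasIrreducibleModPGaloisRep p) (hprime : (Ideal.span {(p : 𝓞 K)}).IsPrime) :
    ∀ k' : ℕ, k' ≠ 0 → ¬ p ∣ k' →
      ∀ (n' : ℕ) (a : (W.baseChange (ringClassField K ι k')).toAffine.Point),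
        ((p ^ n' : ℕ) : ℤ) • a = 0 → a = 0 := by
  intro k' hk' hpk' n' a ha
  have hKunr : ∀ v : HeightOneSpectrum (𝓞 ℚ), (p : 𝓞 ℚ) ∈ v.asIdeal →
      Algebra.IsUnramifiedIn (𝓞 K) v.asIdeal :=
    fun v hv ↦ isUnramifiedIn_of_span_natCast_isPrime hp hprime hv
  have hbot := NoTorsionIrr.torsionBy_pow_ringClassField_eq_bot_of_hasIrreducibleModPGaloisRep W hK ι hk' hp hp2
    hirr (W.exists_weilPairing_holds p) hKunr hpk' n'
  have hmem : a ∈ AddSubgroup.torsionBy (W.baseChange (ringClassField K ι k')).toAffine.Point ((p ^ n' : ℕ) : ℤ) := by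
    rw [mem_torsionBy_iff]
    exact ha
  rw [hbot] at hmem
  exact hmem

/-! ### §4 END — Kolyvagin's UNSHARP ORDER bound on the inert Shimura locus at every multiplicative `p ≥ 5` with `E[p]` irreducible -/

/-- **Kolyvagin's ORDER bound `#Ш(E/K)[p^∞] ≤ p^(2·ord_p[E(K):ℤy])` on the INERT Shimura locus (`p ∈ S`) for EVERY multiplicative
`p ≥ 5` with `E[p]` IRREDUCIBLE — image onto or not — modulo {Poitou–Tate, `casselsTate_levelInputs K`, the labelled CM family}.**
= lane B's `p`-generic image-keyed END `natCard_sha_primary_le_of_shimuraLabels_of_imageInputs_of_casselsTate_of_poitouTate` with its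
five image-side binders (hIz) (hIs) (hIc) (hIt) (htor) DISCHARGED by §2–§3. In the binder currency of item 19718
`ShimuraKolyvaginOrderBoundInertFromFive` (inert clause `hin`, split clause `hsp`, `p ∈ S`), with `5 ≤ p ∧ ρ̄ onto` REPLACED by
`5 ≤ p ∧ Mult W p ∧ Irr W p`, and the CM data in LABEL currency (bottom point `y`, family `ys` with (B2)–(B5), `hB3K`, the guarded
index clause) instead of the Cai–Shu–Tian display. CONDITIONAL on `hPT`, `hCT` and the labels; nothing booked; 19718 ∕ 19065 OPEN.
[cite: Kim2024, Thm. 4.3 (printed twin)] [cite: McCallumLMS1991, §1 Theorem (Kolyvagin), Lemma 5.1, Cor. 5.6] [cite: GrossLMS1991, §2, §9, §10]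
[cite: MilneADT2006, Ch. I Thm. 4.10(b), Thm. 6.13(a)] -/
theorem natCard_sha_primary_le_of_shimuraLabels_of_mult_of_irr_of_casselsTate_of_poitouTate
    {K : Type} [Field K] [NumberField K] {W : WeierstrassCurve ℚ}
    (hPT : Literature.NumberTheory.GaloisCohomology.poitouTate_sum_localTatePairing_eq_zero K)
    (hCT : Literature.NumberTheory.EllipticCurves.casselsTate_levelInputs K)
    [W.IsElliptic] [W.IsGloballyMinimal] {N : ℕ} [NeZero N] (hN : W.conductorNorm ℤ = N)
    {p : ℕ} [Fact p.Prime] (h5 : 5 ≤ p) (hmult : Mult W p) (hirr : Irr W p)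
    (hK : IsImaginaryQuadratic K) (ι : K →+* ℂ)
    (Dt : Literature.NumberTheory.EllipticCurves.ModularForms.ModularParametrizationData W N) {S : Finset ℕ}
    (hin : ∀ ℓ ∈ S, ℓ.Prime ∧ ℓ ∣ N ∧ ¬ ℓ ^ 2 ∣ N ∧
      ((Ideal.span {(ℓ : ℤ)}).primesOver (𝓞 K)).ncard = 1 ∧ ¬ (ℓ : ℤ) ∣ NumberField.discr K)
    (hsp : ∀ ℓ : ℕ, ℓ.Prime → ℓ ∣ N → ℓ ∉ S → ((Ideal.span {(ℓ : ℤ)}).primesOver (𝓞 K)).ncard = 2)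
    (hpS : p ∈ S)
    (ys : (m : ℕ) → (W.baseChange (ringClassField K ι m)).toAffine.Point)
    {y : (W.baseChange K).toAffine.Point} {ε : ℤ} (hε : ε = 1 ∨ ε = -1)
    (hguard : ¬ IsOfFinAddOrder y → 0 < (AddSubgroup.zmultiples y).index)
    (hB2 : ∀ T : Finset (ringClassField K ι 1 ≃ₐ[ℚ] ringClassField K ι 1),
      (∀ g, g ∈ T ↔ g ∈ ringClassGal ι 1) →
      WeierstrassCurve.Affine.Point.map (W' := W)
          (algebraMap K (ringClassField K ι 1)).toRatAlgHom y =
        ∑ g ∈ T, pointGalHom W (ringClassField K ι 1) g (ys 1))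
    (hB3 : ∀ (m : ℕ), m ≠ 0 → ∀ τm : ringClassField K ι m ≃ₐ[ℚ] ringClassField K ι m,
      (∀ x : ringClassField K ι m, ((τm x : ringClassField K ι m) : ℂ) = starRingEnd ℂ x) →
      ∃ σ' ∈ ringClassGal ι m, IsOfFinAddOrder
        (pointGalHom W (ringClassField K ι m) τm (ys m) -
          ε • pointGalHom W (ringClassField K ι m) σ' (ys m)))
    (hB3K : ∀ c : K ≃ₐ[ℚ] K, c ≠ 1 →
      IsOfFinAddOrder (WeierstrassCurve.Affine.Point.map (W' := W) (c : K →ₐ[ℚ] K) y - ε • y))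
    (hB4 : ∀ m : ℕ, Squarefree m →
      (∀ q ∈ m.primeFactors, ¬ q ∣ N ∧ (Ideal.span {(q : 𝓞 K)}).IsPrime) →
      ∀ (ℓ : ℕ) (_ : ℓ ∈ m.primeFactors) (hle : ringClassField K ι (m / ℓ) ≤ ringClassField K ι m)
        (σ : ringClassField K ι m ≃ₐ[ℚ] ringClassField K ι m),
        Subgroup.zpowers σ = ringClassGalOver ι m (m / ℓ) →
        letI : Algebra K ℂ := ι.toAlgebra
        ∑ i ∈ Finset.range (ℓ + 1), pointGalHom W (ringClassField K ι m) (σ ^ i) (ys m) =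
          W.frobeniusTrace ℓ • WeierstrassCurve.Affine.Point.map (W' := W)
            ((RingClassField.inclusion ι hle).restrictScalars ℚ) (ys (m / ℓ)))
    (hB5 : ∀ m : ℕ, Squarefree m →
      (∀ q ∈ m.primeFactors, ¬ q ∣ N ∧ (Ideal.span {(q : 𝓞 K)}).IsPrime) →
      ∀ (ℓ : ℕ) (_ : ℓ ∈ m.primeFactors) [Fact ℓ.Prime] (hΔ : ¬ (ℓ : ℤ) ∣ minimalDiscriminantInt W)
        (φ₀ : absoluteGaloisGroup (ZMod ℓ)), (∀ x : AlgebraicClosure (ZMod ℓ), φ₀ • x = x ^ ℓ) →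
      ∀ (hle : ringClassField K ι (m / ℓ) ≤ ringClassField K ι m)
        (emb : ringClassField K ι m →+* AlgebraicClosure K),
        (∀ x : K, emb (algebraMap K (ringClassField K ι m) x) = algebraMap K (AlgebraicClosure K) x) →
      ∀ (j : (W.baseChange (ringClassField K ι m)).toAffine.Point →+ geomPoints (W.baseChange K)),
        j = WeierstrassCurve.Affine.Point.map (W' := W) emb.toRatAlgHom →
      ∀ γ : ringClassField K ι m ≃ₐ[ℚ] ringClassField K ι m, γ ∈ ringClassGal ι m →
        letI : Algebra K ℂ := ι.toAlgebra
        geomReduction hΔ ((RatClosure.pointsEquiv (K := K) W).symm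
            (j (pointGalHom W (ringClassField K ι m) γ (ys m)))) =
          φ₀ • geomReduction hΔ ((RatClosure.pointsEquiv (K := K) W).symm
            (j (pointGalHom W (ringClassField K ι m) γ
              (WeierstrassCurve.Affine.Point.map (W' := W)
                ((RingClassField.inclusion ι hle).restrictScalars ℚ) (ys (m / ℓ)))))))
    (hnt : ¬ IsOfFinAddOrder y) :
    Nat.card (AddCommGroup.primaryComponent (W.baseChange K).sha p) ≤
      p ^ (2 * padicValNat p (AddSubgroup.zmultiples y).index) := by
  have hp : p.Prime := Fact.out
  have hp2 : p ≠ 2 := by omega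
  have hpd : ¬ (p : ℤ) ∣ NumberField.discr K := (hin p hpS).2.2.2.2
  obtain ⟨hIz, hIs, hIc, hIt⟩ :=
    kolyvaginImageInputs_of_mult_of_irr_of_five_le K W h5 hmult hirr S hN hK hin hsp hpd
  have hprime : (Ideal.span {(p : 𝓞 K)}).IsPrime :=
    isPrime_span_natCast_of_inertClause hK hp (hin p hpS).2.2.2.1 hpd
  exact natCard_sha_primary_le_of_shimuraLabels_of_imageInputs_of_casselsTate_of_poitouTate hPT hCT hN hp2 hIz hIs hIc
    hIt hK ι (ringClass_noTorsion_of_irr_of_inert hK ι W hp hp2 hirr hprime) Dt hin hsp ys hε hguard hB2 hB3 hB3K hB4 hB5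
    hnt

end Summit.BirchSwinnertonDyer.BirchSwinnertonDyer.Theorems.ShimuraKolyvaginOfImage

end
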